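import Summits.CriticalPhenomena.PercolationContinuityZ3.Theorems.Transplant.SkelPhiRootLegBridgeKGT
import Summits.CriticalPhenomena.PercolationContinuityZ3.Theorems.Transplant.SkelFrm1RootHoldsQC
import Summits.CriticalPhenomena.PercolationContinuityZ3.Theorems.Transplant.SkelNegBParamsFoot
import Summits.CriticalPhenomena.PercolationContinuityZ3.Theorems.Transplant.SkelPhiCorridorKGRouteW
import Summits.CriticalPhenomena.PercolationContinuityZ3.Theorems.Transplant.SkelPhiRootSeedS
import Summits.CriticalPhenomena.PercolationContinuityZ3.Theorems.Transplant.SkelFrmBChoiceZoneK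
import Summits.CriticalPhenomena.PercolationContinuityZ3.Theorems.Transplant.SkelFrmBChoiceKit
import Summits.CriticalPhenomena.PercolationContinuityZ3.Theorems.Transplant.SkelFrmBChoiceZone
import Summits.CriticalPhenomena.PercolationContinuityZ3.Theorems.Transplant.SkelFrmBChoiceNums
import Summits.CriticalPhenomena.PercolationContinuityZ3.Theorems.Transplant.SkelFrmBParamsLOA
import Summits.CriticalPhenomena.PercolationContinuityZ3.Theorems.Transplant.SkelPhiCorridorKGValues
import Summits.CriticalPhenomena.PercolationContinuityZ3.Theorems.Transplant.SkelPhiCorridorKGBoxes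
import Summits.CriticalPhenomena.PercolationContinuityZ3.Theorems.Transplant.SkelPhiCorridorKGRegionLo
import Summits.CriticalPhenomena.PercolationContinuityZ3.Theorems.Transplant.SkelFrmBChoiceAtQT
import HarnessLib

/-!
# N2 (frames-only node `SamePDropOfSkeletonFrm₁`, OPEN), (R) column after J13/(R-36)/(R-37): THE ROOT-LEG RESIDUE AT THE CHOICE FUNCTION OF RECORD,
# FIRST AXIS — SKELETON v5-T `PlanarSkeletonFrm.NegB.rootLegAt_frmQ3KT_fst` ((R-40) T twin of `rootLegAt_frmQ3K_fst`: per-axis-cap cells `fcellsT`, `ΓQT/schedOfT`, `choiceAtQ3T`, T leg) ((R-42): the wired seed is the fat seed AT LEVEL `k`, as N1; otherwise = v3 `…Q3C_fst` p354138)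
# (hop → bridge → K-G corridor; EVERY STRUCTURAL BINDER DISCHARGED,
# residual = numeric/geometry rows in the value ledger's vocabulary — parity with p5-g16's (C) per-probe wrappers `reachOblAtHNF_frmQ3_fst/_snd`)

At `(choiceAtQ3 …).AtQNQ O q` the leg of record `Skelφ.rootChainF_of_bridgeSchedC` (SkelPhiRootLegBridgeKG) at the scheme of record `ΓQ` (`rfl`), root
frame `rootFrame φL t 1`, corridor := `kgCorrSched (HK.kgVals_ok₁ N) (HK.kgVals_ok₂ N) (HK.kgVals_split N)` for ONE row-set hypothesis
`HK : Skelφ.KGRows nL ℓL hL vL (KS0.R'0 … mk) ρ qq W` and a run length `N` (stmt-g20: `kgRows0_of …`, `N := kgNv0 …`), read through `runX φL c₁ nL hL 1` at a LANDING VERTEX `c₁` ((R-37): over the lattice point that puts the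
bridge landing at the back end of core 0).  DISCHARGED INSIDE (no binder left), beyond v2: BOTH KIT BLOCKS at ONE kit index `mk` — corridor kit
`Pk := KS0.kit0 t D mk ((Mu+1)·U + 1) (r₀0 … RL)`, bridge kit `Pb := KS0.kit0 t D mk (Mu + 2) (r₀0 … Rb)` (`kit0_ok (kq := 10 | 0)`, `kit0_sizes`,
`hr₀_kit0`, `hreach_kit0`), the bridge level-width rows `hwideb/hdwb/hDwb` (from `hB0 : B.B₀lo ≤ B.B₀hi`, `j ≥ j₀0 = T0 = tanOff`, `kit0_ok`), the
short region `KS.RgK` (`RgK_subset_graphBall`, `card_RgK_le`, `cU := cUA`), the zone rows AT LEVEL `k` (`hΛRgK/hzconnK/hczK/hZρK_of_atQ`, SkelFrmBChoiceZoneK), levels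
`j₀0/j₁0/Rlev0` (`tanOff_kit0`, `R'0_eq`, `hE` by omega), counts `kk0/Nk0` (`hNk0_at`, `counts_atq_root` with `hq1/hq2` from `factsNS_of_atQ`) for BOTH
kits, `η := κ.δr 0 / 2`, `r := RL`, the hop and its prism rows, the seed rows (`kb := KS.Rs t D mk`), `hTne₁` (rows `hc1/hc1R`), the route input
(`hrouteSW_kgCorr(Y)` ∘ `hlongK_of_atQ3/hlongYK_of_atQ3`).  RESIDUAL (named rows; stmt-g20 values / hp-8 g40 + p5-g16 rooms): `HK`, `N`, `hlen`; window
radius `Rπ` with `hr₀R/hr₀bR` (both kits' thresholds below it), the four concentric-radius rows `hRQ/hRB/hRQ'/hRM`, `hρπ : fatRadius … k ≤ Rπ` (stmt `fat_le_Rπ`), `hRs5`; the hop prism's PLANAR fine reading `hkR` + floor `hfR` (J23, replacing v3's graph-radius rows `hRL5/hRLc`);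
landing vertex `c₁`, `D₀`, `hc₁`, the NUMERIC depth row `hRD` (closed prism box, p5's KGBoxes; the prism row `hRdepth` is derived inside); THE BRIDGE: `B`, `hB`, `hB0`, `hBR' : KS0.R'0 ≤ B.R'`, `hc1`, `hc1R`, `hhopB`, `hclear₁`, bridge reach radius
`Rb` with readings `Qb Fb hQb hFb` and THE BRIDGE EVENT `hbridge` (port of N1's `KS.BFs…`/`bridgeData_*` over `inputsExtraAt_of_atQ`); ROOMS `hfoot₁`,
`hfoot₂`, `hlastf`, `hx` (p3-g17 `KS.hx_0`, SkelFrmBChoiceRootLanding) (the corridor clearance `hclear₂` is derived inside from the numeric (R-F2′) row `hX₁ : Rs + q + R′ + nL < φL c₁ 0 − φL t 0` through p5-g16's sharp `kgCorrSched_region_fst_lower`, rows `hnR : R′ ≤ nL`, `hrow`); EXCESS `hR₁` (at `κ.δr 0 / 2`, entrance depth `fatRadius … k + 1` — stmt `hR₁_US`), `hR₁b`, `hR₁r`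
(stmt `SRex_fat_le_Rπ_sub`: floors `r₀0 … + 1 ≤ ex`), `hDm`.  J20 (p3-g17): v3/v4 wired the zone at `M_u` with radius `Rs`, which makes `hR₁b/hR₁r` undischargeable by a q-free floor.
SECOND AXIS: NOT in this file — J16 (design owner, 2026-08-23): the two-window y′-leg is vacuous for large negative drift `vL` (region 1 of `kgCorrSchedY`
always overlaps the seed's y-range; its x-clearance needs `core1Lo 0 > Rs + g + 2|vL|`); (R-38) = N1's B.17 THREE legs (hop → bridge → x-prefix → y′-corridor),
filed separately (`…QD`).
-- non-vacuity: discharged jointly by stmt-g20's value files (`kgRows0_of`, radii, B port, `kgSchedN_le_LfQ`) and the hp-8/p5 rooms files; the rows are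
-- N1's (L-R4) rows (SkelNeg1RootHoldsX/XE/XEA discharged their N1 twins at `bridgeSame …` values) — VACUITY audit item of node₂ (V131).
builds on p205010 (kernel theorem, internal audit signed; external expert review pending) — nothing in this file uses p205010; nothing here is a claim about
the open node `SamePDropOfSkeletonFrm₁`.
Lane `prim-bschramm`, seat `prim-bschramm-p3` (gen 17, successor of gen 16's v3; N2 design owner, (R) column owner); helper file (`--supports stmt-CriticalPhenomena-4575 --as helper`).
[cite: KozmaNitzan2024, §4 p. 28 ((32) at the root), Theorem 6 (pp. 25–31), Lemma 10 (pp. 17–21), Lemma 12 (pp. 23–25)] [cite: MartineauTassion2017, §3.2 Lemma 3.5, §4.3 Lemma 4.2]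
-/

noncomputable section

open MeasureTheory ProbabilityTheory
open scoped ENNReal Classical

namespace Summit.CriticalPhenomena.PercolationContinuityZ3.Theorems

namespace Transplant

open Literature.Probability.Percolation Literature.Probability.LatticeModels SimpleGraph KNCells KNLevels ChainPlanar ChainPara
open Literature.Probability.Percolation.KozmaNitzan.Cells (oth sgOf)
open Literature.Barriers.CriticalPhenomena (graphBall graphBall_mono mem_graphBall_self)
open SkelConc (Consts)
open Skel (winGraph)
open SkelI (tanOff)
open Skelφ (rootFrame RootFootT TargetFootT pgSideHalfW)
open ChainPlanar (ScheduleNP BridgePrm BridgeOK)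
open Skelφ.StepI (OutNS)

namespace Skelφ

variable {V : Type} [DecidableEq V]

/-- **Root-cube footprint from a sup-norm bound, per-axis-cap cells** (T twin of `seedFootS_of_abs_le`). [folklore] -/
theorem seedFootT_of_abs_le (P : PCells2T) (du : MDir) {z : Site 2} {n : ℕ} (hz : ∀ i, |z i| ≤ (n : ℤ)) (hn : ∀ i, n + 1 ≤ 5 * P.r i) :
    -(5 * (P.r du.1 : ℤ)) + 1 ≤ sgOf du * z du.1 ∧ sgOf du * z du.1 ≤ 5 * (P.r du.1 : ℤ) ∧ |z (oth du.1)| ≤ 5 * (P.r (oth du.1) : ℤ) - 1 := by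
  have hsg : sgOf du = 1 ∨ sgOf du = -1 := by unfold sgOf; split_ifs <;> simp
  have h0 := abs_le.1 (hz du.1)
  have h1 := hz (oth du.1)
  have hn0 := hn du.1
  have hn1 := hn (oth du.1)
  refine ⟨?_, ?_, ?_⟩
  · rcases hsg with h | h <;> rw [h] <;> omega
  · rcases hsg with h | h <;> rw [h] <;> omega
  · have := abs_le.1 h1
    exact abs_le.2 ⟨by omega, by omega⟩

/-- **Root-world footprint from two coordinate bounds, per-axis-cap cells** (T twin of `rootFootS_of_abs_le₂`). [folklore] -/
theorem rootFootT_of_abs_le₂ (P : PCells2T) (du : MDir) {z : Site 2} {a b : ℤ} (h0 : |z du.1| ≤ a) (h1 : |z (oth du.1)| ≤ b)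
    (ha : a + 1 ≤ 5 * (P.r du.1 : ℤ)) (hb : b + 2 + P.c du.1 ≤ 5 * (P.r (oth du.1) : ℤ)) : RootFootT P du z := by
  have hsg : sgOf du = 1 ∨ sgOf du = -1 := by unfold sgOf; split_ifs <;> simp
  have h0' := abs_le.1 h0
  have h1' := abs_le.1 h1
  refine ⟨?_, ?_, ?_⟩
  · rcases hsg with h | h <;> rw [h] <;> linarith
  · rcases hsg with h | h <;> rw [h] <;> linarith
  · exact abs_le.2 ⟨by linarith, by linarith⟩

end Skelφ

namespace PlanarSkeletonFrm

namespace NegB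

open Neg

variable {κ : Consts} {V : Type} [DecidableEq V] [Countable V] {G : SimpleGraph V} [G.LocallyFinite] {Φ : PlanarSkeletonFrm G} {t : V} {p : unitInterval}
  {hC : Φ.CylSubcritical p} {gv fv : Neg.FSlot} {Pv : PSlot} {Sv : SSlot} {cv : CSlot} {bv : BSlot} {O : OutNS V} {q : unitInterval}


set_option maxHeartbeats 1600000 in
/-- **THE FIRST-AXIS ROOT LEG AT THE CHOICE FUNCTION OF RECORD — SKELETON v3 (hop → bridge → K-G corridor; structural binders discharged)** (see the
module docstring for what is discharged and what is residual). [cite: KozmaNitzan2024, §4 p. 28 ((32) at the root)] -/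
theorem rootLegAt_frmQ3KT_fst (Lf : ℕ → ℕ) (hAt : (choiceAtQ3T κ Φ t p Pv gv fv Sv cv bv hC).AtQNQ O q) (h1 : Φ.types = {t})
    (hp0 : 0 < (p : ℝ)) (hp1 : (p : ℝ) < 1) (mk : ℕ)
    -- the corridor of record: ONE row set at `R′ := KS0.R'0 … mk` and a run length (stmt-g20 `kgRows0_of`/`kgYRows0_of`, `kgNv0`/`kgNYv0`)
    {ρ qq W : ℕ} (HK : Skelφ.KGRows (nL κ Φ t p O.merged (gOf κ Φ t p O gv) (fOf κ Φ t p O fv)) (ℓL κ Φ t p O.merged (gOf κ Φ t p O gv) (fOf κ Φ t p O fv)) (hL κ Φ t p O.merged (gOf κ Φ t p O gv) (fOf κ Φ t p O fv)) (vL κ Φ t p O.merged (gOf κ Φ t p O gv) (fOf κ Φ t p O fv)) (KS0.R'0 κ Φ t p O.merged mk) ρ qq W) (N : ℕ)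
    -- the window radius about the root: above both kits' late thresholds, below the four concentric radii; the seed radius rows
    {Rπ Rb : ℕ} (hr₀R : KS0.r₀0 t O.merged mk (RL κ Φ t p O gv fv) ≤ Rπ) (hr₀bR : KS0.r₀0 t O.merged mk Rb ≤ Rπ)
    (hRQ : Rπ + 1 ≤ ((schedOfT κ Φ t p O.merged (gOf κ Φ t p O gv) (fOf κ Φ t p O fv) (cOf κ Φ t p O gv fv cv) (Sv κ Φ t p O.merged (gOf κ Φ t p O gv) (fOf κ Φ t p O fv) q))).rQ 0 0) (hRB : Rπ + 1 ≤ ((schedOfT κ Φ t p O.merged (gOf κ Φ t p O gv) (fOf κ Φ t p O fv) (cOf κ Φ t p O gv fv cv) (Sv κ Φ t p O.merged (gOf κ Φ t p O gv) (fOf κ Φ t p O fv) q))).rB 0 0 (((0 : Fin 2), true) : MDir))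
    (hRQ' : Rπ + 1 ≤ ((schedOfT κ Φ t p O.merged (gOf κ Φ t p O gv) (fOf κ Φ t p O fv) (cOf κ Φ t p O gv fv cv) (Sv κ Φ t p O.merged (gOf κ Φ t p O gv) (fOf κ Φ t p O fv) q))).rQ 0 ((0 : Site 2) + stepVec (((0 : Fin 2), true) : MDir))) (hRM : Rπ + 1 ≤ ((schedOfT κ Φ t p O.merged (gOf κ Φ t p O gv) (fOf κ Φ t p O fv) (cOf κ Φ t p O gv fv cv) (Sv κ Φ t p O.merged (gOf κ Φ t p O gv) (fOf κ Φ t p O fv) q))).rM 0 ((0 : Site 2) + stepVec (((0 : Fin 2), true) : MDir)))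
    (hρπ : Skelφ.fatRadius Φ.frame hC O.merged.k ≤ Rπ) (hRs5 : ∀ i, KS.Rs t O.merged mk + 1 ≤ 5 * ((fcellsT κ Φ t p O.merged (gOf κ Φ t p O gv) (fOf κ Φ t p O fv) (cOf κ Φ t p O gv fv cv))).r i)
    -- the hop's prism rows (`∥ := 0`, `⊥ := 1`)
    -- the hop prism's fine footprint READ PLANARLY (J23: N1's `hkR/hfR` shape; p3-g17 `SkelFrmBChoiceHopFoot` discharges both rows): a reading row and a floor row
    {kR₀ kR₁ : ℤ} (hkR : ∀ w ∈ Skelφ.pgramPrismFin G (φL κ Φ t p O.D O.DT.toDataN O.ori (gOf κ Φ t p O gv) (fOf κ Φ t p O fv)) t (nL κ Φ t p O.merged (gOf κ Φ t p O gv) (fOf κ Φ t p O fv)) (hL κ Φ t p O.merged (gOf κ Φ t p O gv) (fOf κ Φ t p O fv)) (3 * (ℓL κ Φ t p O.merged (gOf κ Φ t p O gv) (fOf κ Φ t p O fv))) (RL κ Φ t p O gv fv), |fineA κ Φ t p O.merged (gOf κ Φ t p O gv) (fOf κ Φ t p O fv) (φL κ Φ t p O.D O.DT.toDataN O.ori (gOf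 κ Φ t p O gv) (fOf κ Φ t p O fv)) w 0| ≤ kR₀ ∧ |fineA κ Φ t p O.merged (gOf κ Φ t p O gv) (fOf κ Φ t p O fv) (φL κ Φ t p O.D O.DT.toDataN O.ori (gOf κ Φ t p O gv) (fOf κ Φ t p O fv)) w 1| ≤ kR₁)
    (hfR : kR₀ + 1 ≤ 5 * (((fcellsT κ Φ t p O.merged (gOf κ Φ t p O gv) (fOf κ Φ t p O fv) (cOf κ Φ t p O gv fv cv))).r 0 : ℤ) ∧ kR₁ + 2 + (((fcellsT κ Φ t p O.merged (gOf κ Φ t p O gv) (fOf κ Φ t p O fv) (cOf κ Φ t p O gv fv cv))).c 0 : ℤ) ≤ 5 * (((fcellsT κ Φ t p O.merged (gOf κ Φ t p O gv) (fOf κ Φ t p O fv) (cOf κ Φ t p O gv fv cv))).r 1 : ℤ))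
    -- the landing vertex and the depth row ((R-37): `c₁` over the lattice point putting the bridge landing at the back end of core 0)
    (c₁ : V) {D₀ : ℕ} (hc₁ : c₁ ∈ graphBall G t D₀)
    (hRD : (D₀ : ℤ) +
      (10 + 3) * (((N : ℤ) + 1) * (nL κ Φ t p O.merged (gOf κ Φ t p O gv) (fOf κ Φ t p O fv)) + Skelφ.kgZ₀ (nL κ Φ t p O.merged (gOf κ Φ t p O gv) (fOf κ Φ t p O fv)) (vL κ Φ t p O.merged (gOf κ Φ t p O gv) (fOf κ Φ t p O fv)) (KS0.R'0 κ Φ t p O.merged mk) ρ qq N (Skelφ.kgM₁ (nL κ Φ t p O.merged (gOf κ Φ t p O gv) (fOf κ Φ t p O fv)) (ℓL κ Φ t p O.merged (gOf κ Φ t p O gv) (fOf κ Φ t p O fv)) (hL κ Φ t p O.merged (gOf κ Φ t p O gv) (fOf κ Φ t p O fv)) (KS0.R'0 κ Φ t p O.merged mk) ρ W N) (Skelφ.kgM₂ (nL κ Φ t p O.merged (gOf κ Φ t p O gv) (fOf κ Φ t p O fv)) (ℓL κ Φ t p O.merged (gOf κ Φ t p O gv) (fOf κ Φ t p O fv)) (hL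 κ Φ t p O.merged (gOf κ Φ t p O gv) (fOf κ Φ t p O fv)) (vL κ Φ t p O.merged (gOf κ Φ t p O gv) (fOf κ Φ t p O fv)) (KS0.R'0 κ Φ t p O.merged mk) ρ qq W N) +
        Skelφ.kgZ₁ (nL κ Φ t p O.merged (gOf κ Φ t p O gv) (fOf κ Φ t p O fv)) (ℓL κ Φ t p O.merged (gOf κ Φ t p O gv) (fOf κ Φ t p O fv)) (hL κ Φ t p O.merged (gOf κ Φ t p O gv) (fOf κ Φ t p O fv)) (KS0.R'0 κ Φ t p O.merged mk) ρ W N (Skelφ.kgM₁ (nL κ Φ t p O.merged (gOf κ Φ t p O gv) (fOf κ Φ t p O fv)) (ℓL κ Φ t p O.merged (gOf κ Φ t p O gv) (fOf κ Φ t p O fv)) (hL κ Φ t p O.merged (gOf κ Φ t p O gv) (fOf κ Φ t p O fv)) (KS0.R'0 κ Φ t p O.merged mk) ρ W N) (Skelφ.kgWm₂ (nL κ Φ t p O.merged (gOf κ Φ t p O gv) (fOf κ Φ t p O fv)) (ℓL κ Φ t p O.merged (gOf κ Φ t p O gv) (fOf κ Φ t p O fv)) (hL κ Φ t p O.merged (gOf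 κ Φ t p O gv) (fOf κ Φ t p O fv)) (KS0.R'0 κ Φ t p O.merged mk) ρ W N) (Skelφ.kgWp₂ (nL κ Φ t p O.merged (gOf κ Φ t p O gv) (fOf κ Φ t p O fv)) (ℓL κ Φ t p O.merged (gOf κ Φ t p O gv) (fOf κ Φ t p O fv)) (hL κ Φ t p O.merged (gOf κ Φ t p O gv) (fOf κ Φ t p O fv)) (KS0.R'0 κ Φ t p O.merged mk) ρ W N) (Skelφ.kgM₂ (nL κ Φ t p O.merged (gOf κ Φ t p O gv) (fOf κ Φ t p O fv)) (ℓL κ Φ t p O.merged (gOf κ Φ t p O gv) (fOf κ Φ t p O fv)) (hL κ Φ t p O.merged (gOf κ Φ t p O gv) (fOf κ Φ t p O fv)) (vL κ Φ t p O.merged (gOf κ Φ t p O gv) (fOf κ Φ t p O fv)) (KS0.R'0 κ Φ t p O.merged mk) ρ qq W N)) ≤ Rπ)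
    -- THE BRIDGE (stmt-g20 port of N1's `KS.BFs/BFd/BFt`, `bridgeData_*` over `inputsExtraAt_of_atQ`): frame, hop box = `B₀`, `R′`, core-1 box rows, seed
    -- clearance (R-F1), readings in the root frame at reach radius `Rb`, THE BRIDGE EVENT at accuracy `(κ.δr 0)³`
    (B : BridgePrm) (hB : BridgeOK B) (hB0 : B.B₀lo ≤ B.B₀hi) (hBR' : KS0.R'0 κ Φ t p O.merged mk ≤ B.R')
    (hc1 : B.core1Lo ≤ B.core1Hi) (hc1R : (B.core1Lo 0).natAbs + (B.core1Lo 1).natAbs ≤ Rπ)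
    (hhopB : ∀ w ∈ pgSideHalfW G (φL κ Φ t p O.D O.DT.toDataN O.ori (gOf κ Φ t p O gv) (fOf κ Φ t p O fv)) t (nL κ Φ t p O.merged (gOf κ Φ t p O gv) (fOf κ Φ t p O fv)) (hL κ Φ t p O.merged (gOf κ Φ t p O gv) (fOf κ Φ t p O fv)) (ℓL κ Φ t p O.merged (gOf κ Φ t p O gv) (fOf κ Φ t p O fv)) (RL κ Φ t p O gv fv) 1 (1 * 1), rootFrame (φL κ Φ t p O.D O.DT.toDataN O.ori (gOf κ Φ t p O gv) (fOf κ Φ t p O fv)) t 1 w ∈ Finset.Icc B.B₀lo B.B₀hi)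
    (hclear₁ : (KS.Rs t O.merged mk : ℤ) < B.B₀lo 0 - B.R' - B.pr)
    (Qb Fb : V → Finset V)
    (hQb : ∀ c, ∀ w ∈ Qb c, w ∈ graphBall G c Rb ∧
      rootFrame (φL κ Φ t p O.D O.DT.toDataN O.ori (gOf κ Φ t p O gv) (fOf κ Φ t p O fv)) t 1 w ∈ Finset.Icc (rootFrame (φL κ Φ t p O.D O.DT.toDataN O.ori (gOf κ Φ t p O gv) (fOf κ Φ t p O fv)) t 1 c - ((B.pr : ℕ) : Site 2)) (rootFrame (φL κ Φ t p O.D O.DT.toDataN O.ori (gOf κ Φ t p O gv) (fOf κ Φ t p O fv)) t 1 c + ((B.pr : ℕ) : Site 2)))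
    (hFb : ∀ c, ∀ w ∈ Fb c, w ∈ Qb c ∧ rootFrame (φL κ Φ t p O.D O.DT.toDataN O.ori (gOf κ Φ t p O gv) (fOf κ Φ t p O fv)) t 1 w ∈ Finset.Icc (rootFrame (φL κ Φ t p O.D O.DT.toDataN O.ori (gOf κ Φ t p O gv) (fOf κ Φ t p O fv)) t 1 c + B.dlo) (rootFrame (φL κ Φ t p O.D O.DT.toDataN O.ori (gOf κ Φ t p O gv) (fOf κ Φ t p O fv)) t 1 c + B.dhi))
    (hbridge : ∀ c, 1 - κ.δr 0 ^ 3 < (bondPercolation G q).real (linkIn (↑(Qb c) : Set V) (O.merged.Λ c O.merged.k) (Fb c)))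
    -- ROOM ROWS at the root cell (hp-8 g40 RootRoomsS / p5-g16 readings): footprints, corridor clearance, the cross link, the planar diameter of the cut world
    (hfoot₁ : ∀ w ∈ graphBall G t Rπ, rootFrame (φL κ Φ t p O.D O.DT.toDataN O.ori (gOf κ Φ t p O gv) (fOf κ Φ t p O fv)) t 1 w ∈ Finset.Icc B.regionLo B.regionHi → RootFootT (fcellsT κ Φ t p O.merged (gOf κ Φ t p O gv) (fOf κ Φ t p O fv) (cOf κ Φ t p O gv fv cv)) (((0 : Fin 2), true) : MDir) ((fineOA κ Φ t p O.D O.DT.toDataN O.ori (gOf κ Φ t p O gv) (fOf κ Φ t p O fv)) w))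
    (hfoot₂ : ∀ k ≤ (Skelφ.kgCorrSched (HK.kgVals_ok₁ N) (HK.kgVals_ok₂ N) (HK.kgVals_split N)).N, ∀ w ∈ graphBall G t Rπ, Skelφ.runX (φL κ Φ t p O.D O.DT.toDataN O.ori (gOf κ Φ t p O gv) (fOf κ Φ t p O fv)) c₁ (nL κ Φ t p O.merged (gOf κ Φ t p O gv) (fOf κ Φ t p O fv)) (hL κ Φ t p O.merged (gOf κ Φ t p O gv) (fOf κ Φ t p O fv)) 1 w ∈ (Skelφ.kgCorrSched (HK.kgVals_ok₁ N) (HK.kgVals_ok₂ N) (HK.kgVals_split N)).region k → RootFootT (fcellsT κ Φ t p O.merged (gOf κ Φ t p O gv) (fOf κ Φ t p O fv) (cOf κ Φ t p O gv fv cv)) (((0 : Fin 2), true) : MDir) ((fineOA κ Φ t p O.D O.DT.toDataN O.ori (gOf κ Φ t p O gv) (fOf κ Φ t p O fv)) w))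
    (hlastf : ∀ w ∈ graphBall G t Rπ, Skelφ.runX (φL κ Φ t p O.D O.DT.toDataN O.ori (gOf κ Φ t p O gv) (fOf κ Φ t p O fv)) c₁ (nL κ Φ t p O.merged (gOf κ Φ t p O gv) (fOf κ Φ t p O fv)) (hL κ Φ t p O.merged (gOf κ Φ t p O gv) (fOf κ Φ t p O fv)) 1 w ∈ ScheduleNP.core (Skelφ.kgCorrSched (HK.kgVals_ok₁ N) (HK.kgVals_ok₂ N) (HK.kgVals_split N)) ((Skelφ.kgCorrSched (HK.kgVals_ok₁ N) (HK.kgVals_ok₂ N) (HK.kgVals_split N)).N + 1) → TargetFootT (fcellsT κ Φ t p O.merged (gOf κ Φ t p O gv) (fOf κ Φ t p O fv) (cOf κ Φ t p O gv fv cv)) (bOf κ Φ t p O gv fv bv) (((0 : Fin 2), true) : MDir) ((fineOA κ Φ t p O.D O.DT.toDataN O.ori (gOf κ Φ t p O gv) (fOf κ Φ t p O fv)) w))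
    (hnR : (KS0.R'0 κ Φ t p O.merged mk) ≤ (nL κ Φ t p O.merged (gOf κ Φ t p O gv) (fOf κ Φ t p O fv))) (hrow : (qq : ℤ) + (N + 1) * (KS0.R'0 κ Φ t p O.merged mk) + (((Skelφ.kgM₁ (nL κ Φ t p O.merged (gOf κ Φ t p O gv) (fOf κ Φ t p O fv)) (ℓL κ Φ t p O.merged (gOf κ Φ t p O gv) (fOf κ Φ t p O fv)) (hL κ Φ t p O.merged (gOf κ Φ t p O gv) (fOf κ Φ t p O fv)) (KS0.R'0 κ Φ t p O.merged mk) ρ W N) : ℤ) + 1) * ((KS0.R'0 κ Φ t p O.merged mk) + ρ + |(vL κ Φ t p O.merged (gOf κ Φ t p O gv) (fOf κ Φ t p O fv))|) + (nL κ Φ t p O.merged (gOf κ Φ t p O gv) (fOf κ Φ t p O fv)) ≤ ((N : ℤ) + 1) * (nL κ Φ t p O.merged (gOf κ Φ t p O gv) (fOf κ Φ t p O fv)))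
    (hX₁ : (KS.Rs t O.merged mk : ℤ) + qq + (KS0.R'0 κ Φ t p O.merged mk) + (nL κ Φ t p O.merged (gOf κ Φ t p O gv) (fOf κ Φ t p O fv)) < (φL κ Φ t p O.D O.DT.toDataN O.ori (gOf κ Φ t p O gv) (fOf κ Φ t p O fv)) c₁ 0 - (φL κ Φ t p O.D O.DT.toDataN O.ori (gOf κ Φ t p O gv) (fOf κ Φ t p O fv)) t 0)
    (hx : ∀ w ∈ graphBall G t Rπ, rootFrame (φL κ Φ t p O.D O.DT.toDataN O.ori (gOf κ Φ t p O gv) (fOf κ Φ t p O fv)) t 1 w ∈ Finset.Icc B.core1Lo B.core1Hi → Skelφ.runX (φL κ Φ t p O.D O.DT.toDataN O.ori (gOf κ Φ t p O gv) (fOf κ Φ t p O fv)) c₁ (nL κ Φ t p O.merged (gOf κ Φ t p O gv) (fOf κ Φ t p O fv)) (hL κ Φ t p O.merged (gOf κ Φ t p O gv) (fOf κ Φ t p O fv)) 1 w ∈ ScheduleNP.core (Skelφ.kgCorrSched (HK.kgVals_ok₁ N) (HK.kgVals_ok₂ N) (HK.kgVals_split N)) 0)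
    {φe : V → Site 2} {m R₁ : ℕ}
    (hDm : ∀ d ∈ ((((KSchA.mk (ΓQT κ Φ t p O gv fv Sv cv bv q) q κ.δ : KSchA V ℕ)).U0root (((0 : Fin 2), true) : MDir)).filter fun y => y ∈ graphBall G t Rπ) \ O.merged.Λ t O.merged.k,
      ∀ d' ∈ ((((KSchA.mk (ΓQT κ Φ t p O gv fv Sv cv bv q) q κ.δ : KSchA V ℕ)).U0root (((0 : Fin 2), true) : MDir)).filter fun y => y ∈ graphBall G t Rπ) \ O.merged.Λ t O.merged.k, φe d - φe d' ∈ box 2 m)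
    -- THE RIM-EXCESS DEVICE at the root (stmt SlotsS), at `κ.δr 0 / 2`, entrance depth `Rs + 1`, below both kits' rims
    (hR₁ : ∀ R'', R₁ ≤ R'' → ∀ (Rw : ℕ) (D' B' : Finset V), (∀ d ∈ D', d ∈ graphBall G t Rw) →
      (∀ d ∈ D', ∀ d' ∈ D', φe d - φe d' ∈ box 2 m) → B' ⊆ D' → (∀ a ∈ B', a ∈ graphBall G t (Skelφ.fatRadius Φ.frame hC O.merged.k + 1)) →
        (bondPercolation G q).real (Skel.excess G t R'' D' B') ≤ κ.δr 0 / 2)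
    (hR₁b : R₁ ≤ Rπ - KS0.r₀0 t O.merged mk Rb) (hR₁r : R₁ ≤ Rπ - KS0.r₀0 t O.merged mk (RL κ Φ t p O gv fv))
    -- THE LENGTH ROW (stmt `kgSchedN_le_LfQ`: `N_corridor + 1 ≤ LfQ`; the bridge is the `+1`)
    (hlen : (B.bridgeFrame hB).N + 1 + (Skelφ.kgCorrSched (HK.kgVals_ok₁ N) (HK.kgVals_ok₂ N) (HK.kgVals_split N)).toFrame.N ≤ Lf κ.K₀) :
    ∃ n, n ≤ Lf κ.K₀ ∧ ∃ (c : V) (Rπ : ℕ) (W : Sym2 V → unitInterval) (s : Fin (n + 1) → KNLevels.TStep (winGraph G c Rπ))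
      (T' : Fin (n + 1) → Finset V) (η' : ℝ),
      (∀ T : Finset V, (prodBernoulli W).real (⋃ t' ∈ T, openConn (ΓQT κ Φ t p O gv fv Sv cv bv q).root t') ≤
        (prodBernoulli (pinW (KNLevels.lattW G q) ↑((⟨ΓQT κ Φ t p O gv fv Sv cv bv q, q, κ.δ⟩ : KSchA V ℕ).U₀ G)
          ↑((⟨ΓQT κ Φ t p O gv fv Sv cv bv q, q, κ.δ⟩ : KSchA V ℕ).U₀ G))).real
          (⋃ t' ∈ (↑T : Set V), openConnIn (↑((ΓQT κ Φ t p O gv fv Sv cv bv q).Q (ΓQT κ Φ t p O gv fv Sv cv bv q).a₀ 0 ∪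
            (ΓQT κ Φ t p O gv fv Sv cv bv q).Ewv (ΓQT κ Φ t p O gv fv Sv cv bv q).a₀ 0 (((0 : Fin 2), true) : MDir)) : Set V)
            (ΓQT κ Φ t p O gv fv Sv cv bv q).root t')) ∧
      (∀ i : Fin (n + 1), (s i).L.o = (ΓQT κ Φ t p O gv fv Sv cv bv q).root) ∧
      (∀ i : Fin n, T' (Fin.castSucc i) ⊆ (s i.succ).L.X 0) ∧ (∀ i : Fin (n + 1), T' i ⊆ (s i).T) ∧
      (∀ i : Fin (n + 1), (s i).KitsAtF W q Φ.Δ (κ.δr 0)) ∧ η' ≤ κ.δr 0 / 2 ∧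
      (∀ i : Fin (n + 1), (prodBernoulli W).real (⋃ t' ∈ (s i).T \ T' i, openConn (ΓQT κ Φ t p O gv fv Sv cv bv q).root t') ≤ η') ∧
      1 - κ.δr 0 < (prodBernoulli W).real (s 0).L.reachB ∧
      T' (Fin.last n) ⊆ (ΓQT κ Φ t p O gv fv Sv cv bv q).M (ΓQT κ Φ t p O gv fv Sv cv bv q).a₀ ((0 : Site 2) + stepVec (((0 : Fin 2), true) : MDir)) := by
  have hAt' := atQ3_of_atQ3T hAt
  -- facts at `AtQNQ`
  have hEq : EqNumL κ Φ t p O.merged (gOf κ Φ t p O gv) (fOf κ Φ t p O fv) := eqNumL_of_atQ hAt'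
  obtain ⟨hn1, hℓ1⟩ := one_le_of_eqNumL κ Φ t p O.merged (gOf κ Φ t p O gv) (fOf κ Φ t p O fv) hEq
  have hκL := (clauseL_of_atQ hAt').2
  obtain ⟨-, hq1, hq2, -⟩ := factsNS_of_atQ hAt'
  have hδ0 : 0 < κ.δr 0 := (κ.hδr 0).1
  have hδ1 : κ.δr 0 ≤ 1 := (κ.hδr 0).2
  have hkit : Neg.δkit κ Φ ≤ κ.δr 0 := Neg.δkit_le_δr κ Φ (n := 0) (by norm_num)
  have hlipφ := lip_φL κ Φ t p O.D O.DT.toDataN O.ori (gOf κ Φ t p O gv) (fOf κ Φ t p O fv)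
  have hstepφ := steps_φL κ Φ t p O.D O.DT.toDataN O.ori (gOf κ Φ t p O gv) (fOf κ Φ t p O fv)
  -- the zone AT THE SEED LEVEL `k` ((R-42)): centred, its graph radii (`Rs` for the footprints, `fatRadius k` for the rim device)
  have hcz : ∀ c, c ∈ O.merged.Λ c O.merged.k := hczK_of_atQ hAt'
  have hZρk : ∀ u ∈ O.merged.Λ t O.merged.k, u ∈ graphBall G t (Skelφ.fatRadius Φ.frame hC O.merged.k) := hZρK_of_atQ hAt' t
  -- the fine map: 1-Lipschitz, weak steps, root at the origin
  have hlipψ := lip_fineA_at κ Φ t p O.merged (gOf κ Φ t p O gv) (fOf κ Φ t p O fv) hlipφ hEq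
  have hwsψ := weakSteps_fineA_at κ Φ t p O.merged (gOf κ Φ t p O gv) (fOf κ Φ t p O fv) hstepφ hEq
  have hψ0 := fineA_base_at κ Φ t p O.merged (gOf κ Φ t p O gv) (fOf κ Φ t p O fv) (φL κ Φ t p O.D O.DT.toDataN O.ori (gOf κ Φ t p O gv) (fOf κ Φ t p O fv)) hEq
  -- the short region and the seed rows: depth `Rs`, footprint, along-coordinate bound `kb := Rs`
  have hRg := fun c => KS.RgK_subset_graphBall (G := G) t O.merged mk (KS.φK Φ t O.D O.DT.toDataN O.ori mk) c
  have hZρ : ∀ u ∈ O.merged.Λ t O.merged.k, u ∈ graphBall G t (KS.Rs t O.merged mk) := hZρK_Rs_of_atQ mk hAt' t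
  have hψabs : ∀ {n : ℕ}, ∀ u ∈ graphBall G t n, ∀ i, |fineA κ Φ t p O.merged (gOf κ Φ t p O gv) (fOf κ Φ t p O fv) (φL κ Φ t p O.D O.DT.toDataN O.ori (gOf κ Φ t p O gv) (fOf κ Φ t p O fv)) u i| ≤ (n : ℤ) := by
    intro n u hu i
    have h := Skelφ.abs_sub_le_of_mem_graphBall hlipψ hu i
    rwa [hψ0, Pi.zero_apply, sub_zero] at h
  have hZfoot : ∀ a ∈ O.merged.Λ t O.merged.k,
      -(5 * (((fcellsT κ Φ t p O.merged (gOf κ Φ t p O gv) (fOf κ Φ t p O fv) (cOf κ Φ t p O gv fv cv))).r (((0 : Fin 2), true) : MDir).1 : ℤ)) + 1 ≤ sgOf (((0 : Fin 2), true) : MDir) * fineA κ Φ t p O.merged (gOf κ Φ t p O gv) (fOf κ Φ t p O fv) (φL κ Φ t p O.D O.DT.toDataN O.ori (gOf κ Φ t p O gv) (fOf κ Φ t p O fv)) a (((0 : Fin 2), true) : MDir).1 ∧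
      sgOf (((0 : Fin 2), true) : MDir) * fineA κ Φ t p O.merged (gOf κ Φ t p O gv) (fOf κ Φ t p O fv) (φL κ Φ t p O.D O.DT.toDataN O.ori (gOf κ Φ t p O gv) (fOf κ Φ t p O fv)) a (((0 : Fin 2), true) : MDir).1 ≤ 5 * (((fcellsT κ Φ t p O.merged (gOf κ Φ t p O gv) (fOf κ Φ t p O fv) (cOf κ Φ t p O gv fv cv))).r (((0 : Fin 2), true) : MDir).1 : ℤ) ∧
      |fineA κ Φ t p O.merged (gOf κ Φ t p O gv) (fOf κ Φ t p O fv) (φL κ Φ t p O.D O.DT.toDataN O.ori (gOf κ Φ t p O gv) (fOf κ Φ t p O fv)) a (oth (((0 : Fin 2), true) : MDir).1)| ≤ 5 * (((fcellsT κ Φ t p O.merged (gOf κ Φ t p O gv) (fOf κ Φ t p O fv) (cOf κ Φ t p O gv fv cv))).r (oth (((0 : Fin 2), true) : MDir).1) : ℤ) - 1 :=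
    fun a ha => Skelφ.seedFootT_of_abs_le (fcellsT κ Φ t p O.merged (gOf κ Φ t p O gv) (fOf κ Φ t p O fv) (cOf κ Φ t p O gv fv cv)) (((0 : Fin 2), true) : MDir) (hψabs a (hZρ a ha)) hRs5
  have hZk : ∀ a ∈ O.merged.Λ t O.merged.k, |rootFrame (φL κ Φ t p O.D O.DT.toDataN O.ori (gOf κ Φ t p O gv) (fOf κ Φ t p O fv)) t 1 a 0| ≤ (KS.Rs t O.merged mk : ℤ) := fun a ha => by
    have h := Skelφ.abs_sub_le_of_mem_graphBall hlipφ (hZρ a ha) 0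
    have hrf : rootFrame (φL κ Φ t p O.D O.DT.toDataN O.ori (gOf κ Φ t p O gv) (fOf κ Φ t p O fv)) t 1 a 0 = (φL κ Φ t p O.D O.DT.toDataN O.ori (gOf κ Φ t p O gv) (fOf κ Φ t p O fv)) a 0 - (φL κ Φ t p O.D O.DT.toDataN O.ori (gOf κ Φ t p O gv) (fOf κ Φ t p O fv)) t 0 := by
      show (if (0 : Fin 2) = 0 then (1 : ℤ) * ((φL κ Φ t p O.D O.DT.toDataN O.ori (gOf κ Φ t p O gv) (fOf κ Φ t p O fv)) a 0 - (φL κ Φ t p O.D O.DT.toDataN O.ori (gOf κ Φ t p O gv) (fOf κ Φ t p O fv)) t 0) else (φL κ Φ t p O.D O.DT.toDataN O.ori (gOf κ Φ t p O gv) (fOf κ Φ t p O fv)) a 1 - (φL κ Φ t p O.D O.DT.toDataN O.ori (gOf κ Φ t p O gv) (fOf κ Φ t p O fv)) t 1) = _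
      rw [if_pos rfl, one_mul]
    rw [hrf]; exact h
  -- the two kits at the kit index `mk`: constants, sizes, thresholds, reach
  obtain ⟨hPN, hdD, hDρ, hKCmax, hT, -⟩ := KS0.kit0_ok t O.merged mk ((Mu O.merged + 1 : ℕ) * (Skelφ.shearUnit (nL κ Φ t p O.merged (gOf κ Φ t p O gv) (fOf κ Φ t p O fv)) (hL κ Φ t p O.merged (gOf κ Φ t p O gv) (fOf κ Φ t p O fv)) : ℤ) + 1)
    (KS0.r₀0 t O.merged mk (RL κ Φ t p O gv fv)) (kq := 10) le_rfl
  obtain ⟨hrs, hcS⟩ := KS0.kit0_sizes Φ t O.merged mk ((Mu O.merged + 1 : ℕ) * (Skelφ.shearUnit (nL κ Φ t p O.merged (gOf κ Φ t p O gv) (fOf κ Φ t p O fv)) (hL κ Φ t p O.merged (gOf κ Φ t p O gv) (fOf κ Φ t p O fv)) : ℤ) + 1) (KS0.r₀0 t O.merged mk (RL κ Φ t p O gv fv))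
  obtain ⟨hr₀, -⟩ := KS0.hr₀_kit0 t O.merged mk ((Mu O.merged + 1 : ℕ) * (Skelφ.shearUnit (nL κ Φ t p O.merged (gOf κ Φ t p O gv) (fOf κ Φ t p O fv)) (hL κ Φ t p O.merged (gOf κ Φ t p O gv) (fOf κ Φ t p O fv)) : ℤ) + 1) (KS0.r₀0_ge t O.merged mk (RL κ Φ t p O gv fv)).1
  have hreach := KS0.hreach_kit0 t O.merged mk ((Mu O.merged + 1 : ℕ) * (Skelφ.shearUnit (nL κ Φ t p O.merged (gOf κ Φ t p O gv) (fOf κ Φ t p O fv)) (hL κ Φ t p O.merged (gOf κ Φ t p O gv) (fOf κ Φ t p O fv)) : ℤ) + 1) (KS0.r₀0_ge t O.merged mk (RL κ Φ t p O gv fv)).2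
  obtain ⟨-, hdDb, hDρb, hKCmaxb, hTb, hPNb⟩ := KS0.kit0_ok t O.merged mk ((Mu O.merged : ℤ) + 2) (KS0.r₀0 t O.merged mk Rb) (kq := 0) (by norm_num)
  obtain ⟨hrsb, hcSb⟩ := KS0.kit0_sizes Φ t O.merged mk ((Mu O.merged : ℤ) + 2) (KS0.r₀0 t O.merged mk Rb)
  obtain ⟨hr₀b, -⟩ := KS0.hr₀_kit0 t O.merged mk ((Mu O.merged : ℤ) + 2) (KS0.r₀0_ge t O.merged mk Rb).1
  have hreachb := KS0.hreach_kit0 t O.merged mk ((Mu O.merged : ℤ) + 2) (KS0.r₀0_ge t O.merged mk Rb).2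
  have hRLπ : (RL κ Φ t p O gv fv) ≤ Rπ := le_trans (Nat.le_add_right _ _) ((KS0.r₀0_ge t O.merged mk (RL κ Φ t p O gv fv)).2.trans hr₀R)
  have hRbπ : Rb ≤ Rπ := le_trans (Nat.le_add_right _ _) ((KS0.r₀0_ge t O.merged mk Rb).2.trans hr₀bR)
  -- the counts at the root accuracy, the levels
  obtain ⟨hk, hcount⟩ := KS0.counts_atq_root κ Φ t p O.merged mk hp0 hp1 hq1 hq2
  have hNk := KS0.hNk0_at κ Φ t p O.merged mk hp0 hp1
  have hreach0 : ∀ (A : ℤ) (r₀ : ℕ), KS0.j₁0 κ Φ t p O.merged mk +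
      ((KS0.kit0 t O.merged mk A r₀).N * (tanOff (KS0.kit0 t O.merged mk A r₀).ℓs (KS0.kit0 t O.merged mk A r₀).M + 1) +
        (KS0.kit0 t O.merged mk A r₀).N * (KS0.kit0 t O.merged mk A r₀).d + KS.KCmax t O.merged mk) ≤ KS0.R'0 κ Φ t p O.merged mk := by
    intro A r₀
    rw [KS0.tanOff_kit0]
    simp only [KS0.kit0]
    have h := (KS0.R'0_eq κ Φ t p O.merged mk).1
    unfold KS0.reach0 at h
    omega
  -- the bridge level-width rows from `B₀lo ≤ B₀hi`, `j ≥ j₀0 = T0 = tanOff`, and the kit constants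
  have hT0 : tanOff (KS0.kit0 t O.merged mk ((Mu O.merged : ℤ) + 2) (KS0.r₀0 t O.merged mk Rb)).ℓs (KS0.kit0 t O.merged mk ((Mu O.merged : ℤ) + 2) (KS0.r₀0 t O.merged mk Rb)).M = KS0.j₀0 t O.merged mk := KS0.tanOff_kit0 t O.merged mk _ _
  have hwideb : ∀ j, KS0.j₀0 t O.merged mk ≤ j → j ≤ KS0.j₁0 κ Φ t p O.merged mk → ∀ i,
      (B.B₀lo - (j : Site 2)) i + 2 * tanOff (KS0.kit0 t O.merged mk ((Mu O.merged : ℤ) + 2) (KS0.r₀0 t O.merged mk Rb)).ℓs (KS0.kit0 t O.merged mk ((Mu O.merged : ℤ) + 2) (KS0.r₀0 t O.merged mk Rb)).M ≤ (B.B₀hi + (j : Site 2)) i :=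
    fun j hj0 _ i => Skelφ.icc_level_room hB0 hj0 (by rw [hT0]) i
  have hdwb : ∀ j, KS0.j₀0 t O.merged mk ≤ j → j ≤ KS0.j₁0 κ Φ t p O.merged mk → ∀ i,
      (B.B₀lo - (j : Site 2)) i + ((KS0.kit0 t O.merged mk ((Mu O.merged : ℤ) + 2) (KS0.r₀0 t O.merged mk Rb)).d + 2 : ℕ) ≤ (B.B₀hi + (j : Site 2)) i :=
    fun j hj0 _ i => Skelφ.icc_level_room hB0 hj0 (by have h := hTb; rw [hT0] at h; push_cast at h ⊢; omega) i
  have hDwb : ∀ j, KS0.j₀0 t O.merged mk ≤ j → j ≤ KS0.j₁0 κ Φ t p O.merged mk → ∀ i,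
      (B.B₀lo - (j : Site 2)) i + ((Skelφ.shellD (KS0.kit0 t O.merged mk ((Mu O.merged : ℤ) + 2) (KS0.r₀0 t O.merged mk Rb)) + 1 + (KS0.kit0 t O.merged mk ((Mu O.merged : ℤ) + 2) (KS0.r₀0 t O.merged mk Rb)).d + KS.KCmax t O.merged mk + KS.Rs t O.merged mk : ℕ) : ℤ) ≤ (B.B₀hi + (j : Site 2)) i :=
    fun j hj0 _ i => Skelφ.icc_level_room hB0 hj0 (by have h := hTb; rw [hT0] at h; push_cast at h ⊢; omega) i
  -- the bridge's true target window is nonempty: a frame vertex over the corner `core1Lo`, within the window by `hc1R`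
  have hTne₁ : (Skelφ.Win G (rootFrame (φL κ Φ t p O.D O.DT.toDataN O.ori (gOf κ Φ t p O gv) (fOf κ Φ t p O fv)) t 1) t (Finset.Icc B.core1Lo B.core1Hi) Rπ).Nonempty := by
    obtain ⟨g, hg, hgy⟩ := Skelφ.exists_mem_graphBall_φ_eq hstepφ t ((φL κ Φ t p O.D O.DT.toDataN O.ori (gOf κ Φ t p O gv) (fOf κ Φ t p O fv)) t + B.core1Lo)
    have h0 : ((φL κ Φ t p O.D O.DT.toDataN O.ori (gOf κ Φ t p O gv) (fOf κ Φ t p O fv)) t + B.core1Lo) 0 - (φL κ Φ t p O.D O.DT.toDataN O.ori (gOf κ Φ t p O gv) (fOf κ Φ t p O fv)) t 0 = B.core1Lo 0 := by simp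
    have h1' : ((φL κ Φ t p O.D O.DT.toDataN O.ori (gOf κ Φ t p O gv) (fOf κ Φ t p O fv)) t + B.core1Lo) 1 - (φL κ Φ t p O.D O.DT.toDataN O.ori (gOf κ Φ t p O gv) (fOf κ Φ t p O fv)) t 1 = B.core1Lo 1 := by simp
    rw [h0, h1'] at hg
    refine ⟨g, (Skelφ.mem_Win (G := G) (φ := rootFrame (φL κ Φ t p O.D O.DT.toDataN O.ori (gOf κ Φ t p O gv) (fOf κ Φ t p O fv)) t 1)).2 ⟨graphBall_mono G t hc1R hg, ?_⟩⟩
    have hg0 : (φL κ Φ t p O.D O.DT.toDataN O.ori (gOf κ Φ t p O gv) (fOf κ Φ t p O fv)) g 0 = (φL κ Φ t p O.D O.DT.toDataN O.ori (gOf κ Φ t p O gv) (fOf κ Φ t p O fv)) t 0 + B.core1Lo 0 := by have := congrFun hgy 0; simpa using this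
    have hg1 : (φL κ Φ t p O.D O.DT.toDataN O.ori (gOf κ Φ t p O gv) (fOf κ Φ t p O fv)) g 1 = (φL κ Φ t p O.D O.DT.toDataN O.ori (gOf κ Φ t p O gv) (fOf κ Φ t p O fv)) t 1 + B.core1Lo 1 := by have := congrFun hgy 1; simpa using this
    have hrf : rootFrame (φL κ Φ t p O.D O.DT.toDataN O.ori (gOf κ Φ t p O gv) (fOf κ Φ t p O fv)) t 1 g = B.core1Lo := by
      funext i
      fin_cases i
      · show (if (0 : Fin 2) = 0 then (1 : ℤ) * ((φL κ Φ t p O.D O.DT.toDataN O.ori (gOf κ Φ t p O gv) (fOf κ Φ t p O fv)) g 0 - (φL κ Φ t p O.D O.DT.toDataN O.ori (gOf κ Φ t p O gv) (fOf κ Φ t p O fv)) t 0) else (φL κ Φ t p O.D O.DT.toDataN O.ori (gOf κ Φ t p O gv) (fOf κ Φ t p O fv)) g 1 - (φL κ Φ t p O.D O.DT.toDataN O.ori (gOf κ Φ t p O gv) (fOf κ Φ t p O fv)) t 1) = _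
        rw [if_pos rfl, one_mul, hg0]; simp
      · show (if (1 : Fin 2) = 0 then (1 : ℤ) * ((φL κ Φ t p O.D O.DT.toDataN O.ori (gOf κ Φ t p O gv) (fOf κ Φ t p O fv)) g 0 - (φL κ Φ t p O.D O.DT.toDataN O.ori (gOf κ Φ t p O gv) (fOf κ Φ t p O fv)) t 0) else (φL κ Φ t p O.D O.DT.toDataN O.ori (gOf κ Φ t p O gv) (fOf κ Φ t p O fv)) g 1 - (φL κ Φ t p O.D O.DT.toDataN O.ori (gOf κ Φ t p O gv) (fOf κ Φ t p O fv)) t 1) = _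
        rw [if_neg (by decide), hg1]; simp
    rw [hrf]; exact Finset.mem_Icc.2 ⟨le_rfl, hc1⟩
  -- the hop: the root's own long side half (`τ = 1`), its prism inside the window with root-world footprints, its target inside the bridge box
  have hlink : 1 - κ.δr 0 < (bondPercolation G q).real (linkIn (↑(Skelφ.pgramPrismFin G (φL κ Φ t p O.D O.DT.toDataN O.ori (gOf κ Φ t p O gv) (fOf κ Φ t p O fv)) t (nL κ Φ t p O.merged (gOf κ Φ t p O gv) (fOf κ Φ t p O fv)) (hL κ Φ t p O.merged (gOf κ Φ t p O gv) (fOf κ Φ t p O fv)) (3 * (ℓL κ Φ t p O.merged (gOf κ Φ t p O gv) (fOf κ Φ t p O fv))) (RL κ Φ t p O gv fv)) : Set V)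
      (O.merged.Λ t O.merged.k) (pgSideHalfW G (φL κ Φ t p O.D O.DT.toDataN O.ori (gOf κ Φ t p O gv) (fOf κ Φ t p O fv)) t (nL κ Φ t p O.merged (gOf κ Φ t p O gv) (fOf κ Φ t p O fv)) (hL κ Φ t p O.merged (gOf κ Φ t p O gv) (fOf κ Φ t p O fv)) (ℓL κ Φ t p O.merged (gOf κ Φ t p O gv) (fOf κ Φ t p O fv)) (RL κ Φ t p O gv fv) 1 (1 * 1))) := by
    have h := hlongK_of_atQ3 hAt' h1 hkit t 1 (Or.inl rfl)
    have hcube : κ.δr 0 ^ 3 ≤ κ.δr 0 := pow_le_of_le_one hδ0.le hδ1 (by norm_num)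
    rw [Skelφ.StepI.coe_pgramPrismFin]
    exact lt_of_le_of_lt (sub_le_sub_left hcube 1) h
  have hQπ : ∀ w ∈ Skelφ.pgramPrismFin G (φL κ Φ t p O.D O.DT.toDataN O.ori (gOf κ Φ t p O gv) (fOf κ Φ t p O fv)) t (nL κ Φ t p O.merged (gOf κ Φ t p O gv) (fOf κ Φ t p O fv)) (hL κ Φ t p O.merged (gOf κ Φ t p O gv) (fOf κ Φ t p O fv)) (3 * (ℓL κ Φ t p O.merged (gOf κ Φ t p O gv) (fOf κ Φ t p O fv))) (RL κ Φ t p O gv fv), w ∈ graphBall G t Rπ := fun w hw =>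
    graphBall_mono G t hRLπ (Skelφ.pgramPrism_subset_graphBall (G := G) (φ := (φL κ Φ t p O.D O.DT.toDataN O.ori (gOf κ Φ t p O gv) (fOf κ Φ t p O fv))) t _ _ _ _ ((Skelφ.mem_pgramPrismFin G (φL κ Φ t p O.D O.DT.toDataN O.ori (gOf κ Φ t p O gv) (fOf κ Φ t p O fv))).1 hw))
  have hQfoot : ∀ w ∈ Skelφ.pgramPrismFin G (φL κ Φ t p O.D O.DT.toDataN O.ori (gOf κ Φ t p O gv) (fOf κ Φ t p O fv)) t (nL κ Φ t p O.merged (gOf κ Φ t p O gv) (fOf κ Φ t p O fv)) (hL κ Φ t p O.merged (gOf κ Φ t p O gv) (fOf κ Φ t p O fv)) (3 * (ℓL κ Φ t p O.merged (gOf κ Φ t p O gv) (fOf κ Φ t p O fv))) (RL κ Φ t p O gv fv), RootFootT (fcellsT κ Φ t p O.merged (gOf κ Φ t p O gv) (fOf κ Φ t p O fv) (cOf κ Φ t p O gv fv cv)) (((0 : Fin 2), true) : MDir) (fineA κ Φ t p O.merged (gOf κ Φ t p O gv) (fOf κ Φ t p O fv) (φL κ Φ t p O.D O.DT.toDataN O.ori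 (gOf κ Φ t p O gv) (fOf κ Φ t p O fv)) w) :=
    fun w hw => Skelφ.rootFootT_of_abs_le₂ (fcellsT κ Φ t p O.merged (gOf κ Φ t p O gv) (fOf κ Φ t p O fv) (cOf κ Φ t p O gv fv cv)) (((0 : Fin 2), true) : MDir) (hkR w hw).1 (hkR w hw).2 hfR.1 hfR.2
  have hT₀ : ∀ w ∈ pgSideHalfW G (φL κ Φ t p O.D O.DT.toDataN O.ori (gOf κ Φ t p O gv) (fOf κ Φ t p O fv)) t (nL κ Φ t p O.merged (gOf κ Φ t p O gv) (fOf κ Φ t p O fv)) (hL κ Φ t p O.merged (gOf κ Φ t p O gv) (fOf κ Φ t p O fv)) (ℓL κ Φ t p O.merged (gOf κ Φ t p O gv) (fOf κ Φ t p O fv)) (RL κ Φ t p O gv fv) 1 (1 * 1), w ∈ graphBall G t Rπ ∧ rootFrame (φL κ Φ t p O.D O.DT.toDataN O.ori (gOf κ Φ t p O gv) (fOf κ Φ t p O fv)) t 1 w ∈ Finset.Icc B.B₀lo B.B₀hi :=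
    fun w hw => ⟨graphBall_mono G t hRLπ (Skelφ.pgramPrism_subset_graphBall (G := G) (φ := (φL κ Φ t p O.D O.DT.toDataN O.ori (gOf κ Φ t p O gv) (fOf κ Φ t p O fv))) t _ _ _ _ (Skelφ.coe_pgSideHalfW_subset _ _ _ _ _ _ _ hw)),
      hhopB w hw⟩
  -- the corridor's regions clear the seed ((R-F2′) numerically: `hX₁`): every region lies in `x ≥ −(q + R′ + n)` of the run frame (p5-g16's SHARP
  -- `kgCorrSched_region_fst_lower`, rows `hnR`/`hrow`), i.e. `x ≥ X₁ − q − R′ − n > Rs` in the root frame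
  have hclear₂ : ∀ k ≤ (Skelφ.kgCorrSched (HK.kgVals_ok₁ N) (HK.kgVals_ok₂ N) (HK.kgVals_split N)).N, ∀ w ∈ graphBall G t Rπ, Skelφ.runX (φL κ Φ t p O.D O.DT.toDataN O.ori (gOf κ Φ t p O gv) (fOf κ Φ t p O fv)) c₁ (nL κ Φ t p O.merged (gOf κ Φ t p O gv) (fOf κ Φ t p O fv)) (hL κ Φ t p O.merged (gOf κ Φ t p O gv) (fOf κ Φ t p O fv)) 1 w ∈ (Skelφ.kgCorrSched (HK.kgVals_ok₁ N) (HK.kgVals_ok₂ N) (HK.kgVals_split N)).region k → (KS.Rs t O.merged mk : ℤ) < rootFrame (φL κ Φ t p O.D O.DT.toDataN O.ori (gOf κ Φ t p O gv) (fOf κ Φ t p O fv)) t 1 w 0 := by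
    intro k hk w _ hw
    have h0 := Skelφ.kgCorrSched_region_fst_lower (HK.kgVals_ok₁ N) (HK.kgVals_ok₂ N) (HK.kgVals_split N) hnR hrow hk hw
    rw [Skelφ.runX_zero, Skelφ.relCoord_apply, one_mul] at h0
    have hrf : rootFrame (φL κ Φ t p O.D O.DT.toDataN O.ori (gOf κ Φ t p O gv) (fOf κ Φ t p O fv)) t 1 w 0 = (φL κ Φ t p O.D O.DT.toDataN O.ori (gOf κ Φ t p O gv) (fOf κ Φ t p O fv)) w 0 - (φL κ Φ t p O.D O.DT.toDataN O.ori (gOf κ Φ t p O gv) (fOf κ Φ t p O fv)) t 0 := by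
      show (if (0 : Fin 2) = 0 then (1 : ℤ) * ((φL κ Φ t p O.D O.DT.toDataN O.ori (gOf κ Φ t p O gv) (fOf κ Φ t p O fv)) w 0 - (φL κ Φ t p O.D O.DT.toDataN O.ori (gOf κ Φ t p O gv) (fOf κ Φ t p O fv)) t 0) else (φL κ Φ t p O.D O.DT.toDataN O.ori (gOf κ Φ t p O gv) (fOf κ Φ t p O fv)) w 1 - (φL κ Φ t p O.D O.DT.toDataN O.ori (gOf κ Φ t p O gv) (fOf κ Φ t p O fv)) t 1) = _
      rw [if_pos rfl, one_mul]
    rw [hrf]; linarith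
  -- the depth row over the prism from the closed prism box (p5-g16 KGBoxes)
  have hRdepth : ∀ z ∈ (Skelφ.kgCorrSched (HK.kgVals_ok₁ N) (HK.kgVals_ok₂ N) (HK.kgVals_split N)).prism, D₀ + (10 + 3) * ((z 0).natAbs + (z 1).natAbs) ≤ Rπ := by
    intro z hz
    have h := Skelφ.natAbs_le_of_mem_kgCorrSched_prism (HK.kgVals_ok₁ N) (HK.kgVals_ok₂ N) (HK.kgVals_split N) hz
    have h2 : ((10 : ℤ) + 3) * (((z 0).natAbs : ℤ) + (z 1).natAbs) ≤ ((10 : ℤ) + 3) * _ := mul_le_mul_of_nonneg_left h (by norm_num)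
    have : (D₀ : ℤ) + (10 + 3) * (((z 0).natAbs : ℤ) + (z 1).natAbs) ≤ Rπ := by linarith
    exact_mod_cast this
  -- assemble
  refine ⟨(B.bridgeFrame hB).N + 1 + (Skelφ.kgCorrSched (HK.kgVals_ok₁ N) (HK.kgVals_ok₂ N) (HK.kgVals_split N)).toFrame.N, hlen, ?_⟩
  exact Skelφ.rootChainF_of_bridgeSchedCT hlipφ hstepφ Φ.degree_le hlipψ hwsψ (fcellsT κ Φ t p O.merged (gOf κ Φ t p O gv) (fOf κ Φ t p O fv) (cOf κ Φ t p O gv fv cv)) t (schedOfT κ Φ t p O.merged (gOf κ Φ t p O gv) (fOf κ Φ t p O fv) (cOf κ Φ t p O gv fv cv) (Sv κ Φ t p O.merged (gOf κ Φ t p O gv) (fOf κ Φ t p O fv) q)) (bOf κ Φ t p O gv fv bv) q κ.δ (((0 : Fin 2), true) : MDir) (Or.inl rfl) hRQ hRB hRQ' hRM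
    (fun c => KS.RgK G t O.merged mk (KS.φK Φ t O.D O.DT.toDataN O.ori mk) c) hRg (fun c => KS.card_RgK_le Φ t O.merged mk _ c)
    (Nat.one_le_pow _ _ (Nat.succ_pos _)) O.merged.Λ O.merged.k (hΛRgK_of_atQ mk hAt') (hzconnK_of_atQ hAt') hcz hZρk hρπ hZfoot hZk
    B hB (KS0.kit0 t O.merged mk ((Mu O.merged : ℤ) + 2) (KS0.r₀0 t O.merged mk Rb)) hPNb rfl hdDb hDρb (by simpa using hKCmaxb) ((KS0.R'0_eq κ Φ t p O.merged mk).2.1.le.trans hBR') (KS0.R'0_eq κ Φ t p O.merged mk).2.2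
    hwideb hdwb hDwb hTb hr₀b hr₀bR hrsb hcSb ((hreach0 _ _).trans hBR') hreachb le_rfl hRbπ Qb Fb hQb hFb (KS0.kk0 κ Φ t p O.merged mk) hNk
    hn1 c₁ (Or.inl rfl) hκL (Skelφ.kgCorrSched (HK.kgVals_ok₁ N) (HK.kgVals_ok₂ N) (HK.kgVals_split N)) (KS0.kit0 t O.merged mk ((Mu O.merged + 1 : ℕ) * (Skelφ.shearUnit (nL κ Φ t p O.merged (gOf κ Φ t p O gv) (fOf κ Φ t p O fv)) (hL κ Φ t p O.merged (gOf κ Φ t p O gv) (fOf κ Φ t p O fv)) : ℤ) + 1) (KS0.r₀0 t O.merged mk (RL κ Φ t p O gv fv))) hPN rfl hdD hDρ hKCmax hT hr₀ hr₀R hrs hcS hreach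
    (KS0.tanOff_kit0 t O.merged mk _ _).le (KS0.R'0_eq κ Φ t p O.merged mk).2.2 (KS0.R'0_eq κ Φ t p O.merged mk).2.1.le (hreach0 _ _)
    (KS0.kk0 κ Φ t p O.merged mk) hNk hc₁ hRdepth
    hfoot₁ hfoot₂ hclear₁ hclear₂ hTne₁ hx hlastf hδ0 le_rfl hlink hQπ hQfoot hT₀ hcount hcount hk hk hbridge
    (fun hWD => Skelφ.hrouteSW_kgCorr (HK.kgVals_ok₁ N) (HK.kgVals_ok₂ N) (HK.kgVals_split N) hn1 c₁ (Or.inl rfl) le_rfl hRLπ _ hWD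
      O.merged.Λ O.merged.k (hlongK_of_atQ3 hAt' h1 hkit) (hlongYK_of_atQ3 hAt' h1 hkit))
    hR₁ hR₁b hR₁r hDm

end NegB

end PlanarSkeletonFrm

end Transplant

end Summit.CriticalPhenomena.PercolationContinuityZ3.Theorems

end
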